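import Mathlib
import HarnessLib
import Summits.HubbardSuperconductivity.HubbardSuperconductivity.Theorems.KLProgrammeKLRegimeTwoVolumeLipDoorToKit

/-!
# Route `KLProgramme` — crux K3 ENGINE (stmt-HubbardSuperconductivity-20437), stub (e) proof-input «(e)-D-ROWS», F-D5c′ (iii): THE NEAR BRACKET OF THE
# COVARIANCE-DEFECT SOURCE IN KIT FORM — E1's dictionary applied to the near part of `…TwoVolumeLipDefectStep.lipSourceDefect_le`
# (seat hubbard-kl-k3c4-p1 g24; `--supports` 20437; DROWS-SCOPE-g24 v10 §12.2 N7 / §12.4: `Es` → `…TwoVolumeLipSourceLaw.src_le_law`)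

The source-defect profile `Es` of the (Db) row is the pinned sum of the covariance-defect source of block `k` at a deep pin, bounded by
`…LipDefectStep.lipSourceDefect_le` = NEAR bracket (entry first order with the far row tail `T` + graded orders `≥ 2` at `α := 2T` + tail, Gram constant `κ_n`,
radius `ρ_n`, profile `Nn`) + FAR bracket.  g22's law reading `…TwoVolumeLipSourceLaw.src_le_law` consumes the near bracket in KIT form
(`(p+1)(2p+1)·σₑ·(μ(p+1) + towerFO D σₙ μ (p+1)) + Σ_{n∈[2,N]} eΦ^{n−1}ψ^p·towerS D τ μ n p + ψ^p e V(ΦV)^N/(1−ΦV)`), its far bracket goes to `farSrc_le_law` after the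
half-degree re-indexing `…TwoVolumeLipFarHalfDegree`.  This file is the near bracket's door → kit step (pure real analysis, generic label type `Γ`, output degree
`n + 1 = 2p`): the entry first order by `…TwoVolumeLipDoorToKit.doorEntryBinomial_le_foSrc` (after rewriting `n+1+2 = 2p+2`, `(2p+1)(2p+2)/2 = (p+1)(2p+1)` and the
`if`-condition `2p+2 ≤ 2m′ ↔ p+1 ≤ m′`), the graded orders + tail by E1's `…EngineTowerDoorToKit.doorGraded_le_kitStep` at `α := 2T` (`σₑ := T`, `σₙ := κ²`,
`Φ := e(2T)/κ²`, `ψ := ρ⁻²`, `τ := (e²(κ+ρ))²`, `N := N₀ − 1`).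

* `entryFO_cast_eq` — `((2p+1)(2p+2) : ℕ)/2 = ((p+1)(2p+1) : ℕ)` in `ℝ`;
* **`srcNearDoor_le_kit`** — the displayed domination under the kit guard `Φ·towerV D τ N < 1` (`N ≥ 0`, `N 0 = 0`, `D ≥ |Γ|/2`, `N₀ ≥ 2`, `T ≥ 0`).

Pure real analysis; nothing about the model is asserted; nothing asserts the (D) rows, stub (e), VL, K3 or superconductivity.
References: BGM 2006 §2.8 (2.86)–(2.90), §3 [cite: BenfattoGiulianiMastropietro2006].
-/

noncomputable section

namespace Summit.HubbardSuperconductivity.HubbardSuperconductivity.Theorems.TwoVolumeDefect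

set_option linter.dupNamespace false -- summit = problem name (single-conjunct summit), D-0017

open Finset Literature.MathematicalPhysics.QuantumLattice
open Summit.HubbardSuperconductivity.HubbardSuperconductivity.Theorems.EngineV8

/-- `(2p+1)(2p+2)/2 = (p+1)(2p+1)` (cast to `ℝ`). -/
theorem entryFO_cast_eq (p : ℕ) : ((((2 * p + 1) * (2 * p + 2) : ℕ)) : ℝ) / 2 = (((p + 1) * (2 * p + 1) : ℕ) : ℝ) := by
  push_cast; ring

/-- **The near bracket of the covariance-defect source in kit form.** -/
theorem srcNearDoor_le_kit {Γ : Type*} [Fintype Γ] {κ ρ T : ℝ} (hκ : 0 < κ) (hρ : 0 < ρ) (hT : 0 ≤ T)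
    {N : ℕ → ℝ} (hN0 : ∀ m, 0 ≤ N m) (hN00 : N 0 = 0) {D : ℕ} (hD : Fintype.card Γ / 2 ≤ D) {N₀ : ℕ} (hN₀ : 2 ≤ N₀)
    {n p : ℕ} (hnp : n + 1 = 2 * p)
    (hguard : Real.exp 1 * (2 * T) / κ ^ 2 * towerV D ((Real.exp 2 * (κ + ρ)) ^ 2) N < 1) :
      (((n + 1 + 1) * (n + 1 + 2) : ℕ) : ℝ) / 2 * T *
          ∑ m' ∈ range (Fintype.card (Γ) / 2 + 1),
            (if n + 1 + 2 ≤ 2 * m' then ((2 * m').choose (n + 1 + 2) : ℝ) * κ ^ (2 * m' - (n + 1 + 2)) * N m' else 0) +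
        (∑ n' ∈ Ico 2 N₀, (ρ⁻¹ ^ (n + 1) * κ⁻¹ ^ (2 * (n' - 1)) * ((2 * T) ^ (n' - 1) * Real.exp n')) *
            ∑ δ ∈ (Fintype.piFinset fun _ : Fin n' => range (Fintype.card (Γ) / 2 + 1))
                with n + 1 + 2 * (n' - 1) ≤ ∑ a, 2 * δ a,
              ∏ a, (Real.exp 2 * (κ + ρ)) ^ (2 * δ a) * N (δ a) +
          ρ⁻¹ ^ (n + 1) * (Real.exp 1 * normV (Γ) κ ρ N) *
            (Real.exp 1 * (2 * T) * normV (Γ) κ ρ N / κ ^ 2) ^ (N₀ - 1) /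
              (1 - Real.exp 1 * (2 * T) * normV (Γ) κ ρ N / κ ^ 2)) ≤
      (((p + 1) * (2 * p + 1) : ℕ) : ℝ) * T * (N (p + 1) + towerFO D (κ ^ 2) N (p + 1)) +
      (∑ n' ∈ Icc 2 (N₀ - 1), Real.exp 1 * (Real.exp 1 * (2 * T) / κ ^ 2) ^ (n' - 1) * (ρ⁻¹ ^ 2) ^ p * towerS D ((Real.exp 2 * (κ + ρ)) ^ 2) N n' p +
        (ρ⁻¹ ^ 2) ^ p * (Real.exp 1 * towerV D ((Real.exp 2 * (κ + ρ)) ^ 2) N * ((Real.exp 1 * (2 * T) / κ ^ 2) * towerV D ((Real.exp 2 * (κ + ρ)) ^ 2) N) ^ (N₀ - 1) /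
          (1 - (Real.exp 1 * (2 * T) / κ ^ 2) * towerV D ((Real.exp 2 * (κ + ρ)) ^ 2) N))) := by
  have h2T : 0 ≤ 2 * T := by positivity
  have hFO := doorEntryBinomial_le_foSrc (D := D) (DΓ := Fintype.card Γ / 2) hκ.le hT hN0 hD p
  have hGR := doorGraded_le_kitStep (Γ := Γ) hκ hρ h2T hN0 hN00 hD hN₀ hnp hguard
  have h1 : n + 1 + 1 = 2 * p + 1 := by omega
  have h2 : n + 1 + 2 = 2 * p + 2 := by omega
  rw [h1, h2, entryFO_cast_eq]
  have hsum : ∑ m' ∈ range (Fintype.card Γ / 2 + 1),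
      (if 2 * p + 2 ≤ 2 * m' then ((2 * m').choose (2 * p + 2) : ℝ) * κ ^ (2 * m' - (2 * p + 2)) * N m' else 0) =
      ∑ m' ∈ range (Fintype.card Γ / 2 + 1),
        (if p + 1 ≤ m' then ((2 * m').choose (2 * p + 2) : ℝ) * κ ^ (2 * m' - (2 * p + 2)) * N m' else 0) := by
    refine sum_congr rfl fun m' _ => ?_
    by_cases h : p + 1 ≤ m'
    · rw [if_pos h, if_pos (by omega)]
    · rw [if_neg h, if_neg (by omega)]
  rw [hsum]
  exact add_le_add hFO hGR

end Summit.HubbardSuperconductivity.HubbardSuperconductivity.Theorems.TwoVolumeDefect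

end
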